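import Mathlib
import HarnessLib
import Summits.HubbardSuperconductivity.HubbardSuperconductivity.Theorems.ComplexGFFStiffnessDefs
import Summits.HubbardSuperconductivity.HubbardSuperconductivity.Theorems.ComplexGFFStiffnessHypACumulantPertK
import Summits.HubbardSuperconductivity.HubbardSuperconductivity.Theorems.ComplexGFFStiffnessHypACumulantZOfGNV

/-!
# Crux `HypALocalTwoPoint`, line `gnv` — the perturbation `𝒦_g` is `O(g)` in the weighted `C^{r₀}` norm

Route `route-HubbardSuperconductivity-ComplexGFFStiffness`, crux item stmt-HubbardSuperconductivity-19155
(`…Theses.ComplexGFFStiffness.HypALocalTwoPoint`), registered stub `stub_twoPointGivenZ : TwoPointGivenZ`.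
Second piece of the reduction of the stub to `…Theorems.ComplexGFF.OnePointLipschitz` (Lipschitz
continuity of the one-point functions in the perturbation): the distance of the model's perturbation
`𝒦_g = exp(−ig𝒜) − 1` (`pertK g`) from `𝒦_0 = 0` in the weighted `C^{r₀}` norm is LINEAR in `g`.
`…ZOfGNV.norm_iteratedFDeriv_pertK_le` bounds `‖D^k 𝒦_g‖` by `g^{1/3}` only (homogeneity
`𝒦_g = 𝒦_1 ∘ g^{1/3}·id`); here Mathlib's bound for the derivatives of a composition
(`norm_iteratedFDeriv_comp_le`, outer function `exp` with all derivatives of norm `1` at imaginary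
points, inner function `−ig𝒜` with all derivatives `≤ g·18(1+‖z‖)²`) is run at coupling `g` directly,
with the radius `D = max(m, m^{1/k})`, `m = g·18(1+‖z‖)²`, so that `D^k ≤ g·(18(1+‖z‖)²)^k` for `g ≤ 1`.

## Contents (all proved; no definition, no named fact)
* `norm_iteratedFDeriv_pertK_le_linear` — `‖D^k 𝒦_g(z)‖ ≤ k!·g·(18(1+‖z‖)²)^k` (`k ≥ 1`, `0 ≤ g ≤ 1`);
* `one_add_pow_le_exp_eighth` — `(1+s)^m ≤ C_m e^{s²/8}` (`s ≥ 0`);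
* `norm_iteratedFDeriv_pertK_le_linear_weighted` — for every `r₀` there is `B > 0` with
  `‖D^k 𝒦_g(z)‖ ≤ (B·g)·exp(⅛ Σ_i z_i²)` for all `k ≤ r₀`, `0 ≤ g ≤ 1`, `z ∈ ℝ⁴`
  (the derivative clause of `IsIotaAdmissibleWt r₀ (1/8) (B·g) (pertK g)`).

## References
* S. Adams, S. Buchholz, R. Kotecký, S. Müller, arXiv:1910.13564, Sec. 2.1 (the weighted norm
  `‖·‖_{ζ,𝒬}` of the space `E` of perturbations) [AdamsBuchholzKoteckyMuller2019].
-/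

noncomputable section

-- `Summit.<Summit>.<Problem>`: single-conjunct summit, the duplicate component is mandated (D-0017).
set_option linter.dupNamespace false

namespace Summit.HubbardSuperconductivity.HubbardSuperconductivity.Theorems.ComplexGFF

open scoped BigOperators

/-- **Linear-in-`g` derivative bound**: `‖D^k 𝒦_g(y)‖ ≤ k!·g·(18(1+‖y‖)²)^k` for `k ≥ 1` and
`0 ≤ g ≤ 1`. -/
theorem norm_iteratedFDeriv_pertK_le_linear {k : ℕ} (hk : 1 ≤ k) {g : ℝ} (hg0 : 0 ≤ g) (hg1 : g ≤ 1)
    (y : Fin 4 → ℝ) :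
    ‖iteratedFDeriv ℝ k (pertK g) y‖ ≤ (k.factorial : ℝ) * g * (18 * (1 + ‖y‖) ^ 2) ^ k := by
  obtain ⟨P, hPn, hP, h⟩ := pertK_eq_exp_comp g
  have hphase : ∀ {m : WithTop ℕ∞}, ContDiff ℝ m ((fun t => P t) ∘ berryVertex) :=
    P.contDiff.comp contDiff_berryVertex
  rw [h, iteratedFDeriv_add ((Complex.contDiff_exp (𝕜 := ℝ)).comp hphase) contDiff_const,
    iteratedFDeriv_const_of_ne (by omega : k ≠ 0), Pi.add_apply, Pi.zero_apply, add_zero]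
  have hC : ∀ i, i ≤ k → ‖iteratedFDeriv ℝ i Complex.exp (((fun t => P t) ∘ berryVertex) y)‖ ≤ 1 := by
    intro i _
    rw [norm_iteratedFDeriv_cexp, Function.comp_apply, hP]
    simp
  have hPg : ‖P‖ ≤ g := by rwa [abs_of_nonneg hg0] at hPn
  set X : ℝ := 18 * (1 + ‖y‖) ^ 2 with hXdef
  have hX1 : 1 ≤ X := by rw [hXdef]; nlinarith [norm_nonneg y]
  have hX0 : 0 ≤ X := zero_le_one.trans hX1
  set m : ℝ := g * X with hmdef
  have hm0 : 0 ≤ m := mul_nonneg hg0 hX0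
  have hDi : ∀ i, 1 ≤ i → i ≤ k →
      ‖iteratedFDeriv ℝ i ((fun t => P t) ∘ berryVertex) y‖ ≤ m := by
    intro i hi _
    rw [P.iteratedFDeriv_comp_left ((contDiff_berryVertex (m := ⊤)).contDiffAt (x := y))
      (i := i) le_top]
    refine le_trans (ContinuousLinearMap.norm_compContinuousMultilinearMap_le _ _) ?_
    exact mul_le_mul hPg (norm_iteratedFDeriv_berryVertex_le hi y) (norm_nonneg _) hg0
  -- the radius `D = max(m, m^{1/k})`: `m ≤ D^i` for `1 ≤ i ≤ k` and `D^k ≤ g X^k`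
  have hk0 : k ≠ 0 := by omega
  set r : ℝ := m ^ ((k : ℝ)⁻¹) with hrdef
  have hr0 : 0 ≤ r := Real.rpow_nonneg hm0 _
  have hrk : r ^ k = m := Real.rpow_inv_natCast_pow hm0 hk0
  set Dd : ℝ := max m r with hDdef
  have hD : ∀ i, 1 ≤ i → i ≤ k →
      ‖iteratedFDeriv ℝ i ((fun t => P t) ∘ berryVertex) y‖ ≤ Dd ^ i := by
    intro i hi hik
    refine (hDi i hi hik).trans ?_
    rcases le_or_gt 1 m with h1 | h1
    · calc m ≤ Dd := le_max_left _ _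
        _ = Dd ^ 1 := (pow_one _).symm
        _ ≤ Dd ^ i := pow_le_pow_right₀ (h1.trans (le_max_left _ _)) hi
    · have hr1 : r ≤ 1 := Real.rpow_le_one hm0 h1.le (by positivity)
      calc m = r ^ k := hrk.symm
        _ ≤ r ^ i := pow_le_pow_of_le_one hr0 hr1 hik
        _ ≤ Dd ^ i := pow_le_pow_left₀ hr0 (le_max_right _ _) i
  have hmain := norm_iteratedFDeriv_comp_le (Complex.contDiff_exp (𝕜 := ℝ)) hphase
    (n := k) (N := ⊤) le_top y hC hD
  have hDk : Dd ^ k ≤ g * X ^ k := by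
    rcases max_choice m r with hc | hc
    · rw [hDdef, hc, hmdef, mul_pow]
      exact mul_le_mul_of_nonneg_right (pow_le_of_le_one hg0 hg1 hk0) (pow_nonneg hX0 k)
    · rw [hDdef, hc, hrk, hmdef]
      exact mul_le_mul_of_nonneg_left (le_self_pow₀ hX1 hk0) hg0
  calc ‖iteratedFDeriv ℝ k (Complex.exp ∘ ((fun t => P t) ∘ berryVertex)) y‖
      ≤ (k.factorial : ℝ) * 1 * Dd ^ k := hmain
    _ ≤ (k.factorial : ℝ) * 1 * (g * X ^ k) := by gcongr
    _ = (k.factorial : ℝ) * g * X ^ k := by ring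

/-- Polynomial weights are dominated by the Gaussian weight `e^{s²/8}`. -/
theorem one_add_pow_le_exp_eighth (m : ℕ) :
    ∃ C : ℝ, 0 < C ∧ ∀ s : ℝ, 0 ≤ s → (1 + s) ^ m ≤ C * Real.exp (s ^ 2 / 8) := by
  refine ⟨2 ^ m * (8 ^ m * m.factorial) + 2 ^ m, by positivity, fun s hs => ?_⟩
  have hexp1 : 1 ≤ Real.exp (s ^ 2 / 8) := Real.one_le_exp (by positivity)
  rcases le_or_gt s 1 with h1 | h1
  · have h2 : (1 + s) ^ m ≤ 2 ^ m := pow_le_pow_left₀ (by linarith) (by linarith) m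
    calc (1 + s) ^ m ≤ 2 ^ m := h2
      _ ≤ (2 ^ m * (8 ^ m * m.factorial) + 2 ^ m) * 1 := by
          rw [mul_one]; exact le_add_of_nonneg_left (by positivity)
      _ ≤ (2 ^ m * (8 ^ m * m.factorial) + 2 ^ m) * Real.exp (s ^ 2 / 8) :=
          mul_le_mul_of_nonneg_left hexp1 (by positivity)
  · have h2 : (1 + s) ^ m ≤ (2 * s) ^ m := pow_le_pow_left₀ (by linarith) (by linarith) m
    have h3 : s ^ m ≤ s ^ (2 * m) := pow_le_pow_right₀ h1.le (by omega)
    have h4 : (s ^ 2 / 8) ^ m / m.factorial ≤ Real.exp (s ^ 2 / 8) :=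
      Real.pow_div_factorial_le_exp _ (by positivity) m
    have hm : (0 : ℝ) < m.factorial := by exact_mod_cast m.factorial_pos
    rw [div_le_iff₀ hm] at h4
    have h5 : s ^ (2 * m) = 8 ^ m * (s ^ 2 / 8) ^ m := by
      rw [pow_mul, ← mul_pow]
      congr 1
      ring
    calc (1 + s) ^ m ≤ (2 * s) ^ m := h2
      _ = 2 ^ m * s ^ m := mul_pow 2 s m
      _ ≤ 2 ^ m * s ^ (2 * m) := mul_le_mul_of_nonneg_left h3 (by positivity)
      _ = 2 ^ m * (8 ^ m * (s ^ 2 / 8) ^ m) := by rw [h5]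
      _ ≤ 2 ^ m * (8 ^ m * (Real.exp (s ^ 2 / 8) * m.factorial)) := by gcongr
      _ = 2 ^ m * (8 ^ m * m.factorial) * Real.exp (s ^ 2 / 8) := by ring
      _ ≤ (2 ^ m * (8 ^ m * m.factorial) + 2 ^ m) * Real.exp (s ^ 2 / 8) := by
          gcongr
          exact le_add_of_nonneg_right (by positivity)

/-- **The weighted `C^{r₀}` size of `𝒦_g` is `O(g)`**: for every order `r₀` there is `B > 0` with
`‖D^k 𝒦_g(z)‖ ≤ (B·g) · exp(⅛ Σ_i z_i²)` for all `k ≤ r₀`, `0 ≤ g ≤ 1` and `z ∈ ℝ⁴` — the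
derivative clause of `IsIotaAdmissibleWt r₀ (1/8) (B·g) (pertK g)`, i.e. `‖𝒦_g − 𝒦_0‖ ≤ B·g` in the
weighted norm with Gaussian weight `exp(|z|²/8)`. -/
theorem norm_iteratedFDeriv_pertK_le_linear_weighted (r₀ : ℕ) :
    ∃ B : ℝ, 0 < B ∧ ∀ g : ℝ, 0 ≤ g → g ≤ 1 → ∀ k : ℕ, k ≤ r₀ → ∀ z : Fin 4 → ℝ,
      ‖iteratedFDeriv ℝ k (pertK g) z‖
        ≤ B * g * Real.exp (1 / 8 * ∑ i : Fin 4, (z i) ^ 2) := by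
  obtain ⟨C, hC, hCle⟩ := one_add_pow_le_exp_eighth (2 * r₀ + 3)
  set A : ℝ := max 3 ((r₀.factorial : ℝ) * 18 ^ r₀) with hAdef
  have hA3 : (3 : ℝ) ≤ A := le_max_left _ _
  have hAr : (r₀.factorial : ℝ) * 18 ^ r₀ ≤ A := le_max_right _ _
  have hA0 : 0 < A := lt_of_lt_of_le (by norm_num) hA3
  refine ⟨A * C, by positivity, ?_⟩
  intro g hg0 hg1 k hk z
  have hz : 0 ≤ ‖z‖ := norm_nonneg z
  have h1z : 1 ≤ 1 + ‖z‖ := by linarith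
  -- Step 1: `‖D^k 𝒦_g(z)‖ ≤ g · A · (1 + ‖z‖)^{2 r₀ + 3}`
  have step1 : ‖iteratedFDeriv ℝ k (pertK g) z‖ ≤ g * A * (1 + ‖z‖) ^ (2 * r₀ + 3) := by
    rcases Nat.eq_zero_or_pos k with hk0 | hkpos
    · subst hk0
      rw [norm_iteratedFDeriv_zero]
      have h := norm_pertK_le hg0 z
      have hzz : ‖z‖ ^ 3 ≤ (1 + ‖z‖) ^ (2 * r₀ + 3) :=
        le_trans (pow_le_pow_left₀ hz (by linarith) 3) (pow_le_pow_right₀ h1z (by omega))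
      calc ‖pertK g z‖ ≤ 3 * g * ‖z‖ ^ 3 := h
        _ ≤ A * g * (1 + ‖z‖) ^ (2 * r₀ + 3) := by
            apply mul_le_mul (mul_le_mul_of_nonneg_right hA3 hg0) hzz (pow_nonneg hz 3)
              (by positivity)
        _ = g * A * (1 + ‖z‖) ^ (2 * r₀ + 3) := by ring
    · have h := norm_iteratedFDeriv_pertK_le_linear hkpos hg0 hg1 z
      have h18' : (1 : ℝ) ≤ 18 * (1 + ‖z‖) ^ 2 := by nlinarith
      have hfac : (k.factorial : ℝ) ≤ r₀.factorial := by exact_mod_cast Nat.factorial_le hk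
      have hpow : ((18 : ℝ) * (1 + ‖z‖) ^ 2) ^ k ≤ (18 * (1 + ‖z‖) ^ 2) ^ r₀ :=
        pow_le_pow_right₀ h18' hk
      have hpoly : ((18 : ℝ) * (1 + ‖z‖) ^ 2) ^ r₀ = 18 ^ r₀ * (1 + ‖z‖) ^ (2 * r₀) := by
        rw [mul_pow, ← pow_mul]
      calc ‖iteratedFDeriv ℝ k (pertK g) z‖
          ≤ (k.factorial : ℝ) * g * (18 * (1 + ‖z‖) ^ 2) ^ k := h
        _ ≤ (r₀.factorial : ℝ) * g * (18 ^ r₀ * (1 + ‖z‖) ^ (2 * r₀ + 3)) := by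
            have h2 : ((18 : ℝ) * (1 + ‖z‖) ^ 2) ^ k ≤ 18 ^ r₀ * (1 + ‖z‖) ^ (2 * r₀ + 3) := by
              calc ((18 : ℝ) * (1 + ‖z‖) ^ 2) ^ k ≤ (18 * (1 + ‖z‖) ^ 2) ^ r₀ := hpow
                _ = 18 ^ r₀ * (1 + ‖z‖) ^ (2 * r₀) := hpoly
                _ ≤ 18 ^ r₀ * (1 + ‖z‖) ^ (2 * r₀ + 3) :=
                    mul_le_mul_of_nonneg_left (pow_le_pow_right₀ h1z (by omega)) (by positivity)
            apply mul_le_mul (mul_le_mul_of_nonneg_right hfac hg0) h2 (by positivity) (by positivity)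
        _ = g * ((r₀.factorial : ℝ) * 18 ^ r₀) * (1 + ‖z‖) ^ (2 * r₀ + 3) := by ring
        _ ≤ g * A * (1 + ‖z‖) ^ (2 * r₀ + 3) := by gcongr
  -- Step 2: the polynomial weight is dominated by the Gaussian weight `e^{|z|²/8}`
  have step2 : (1 + ‖z‖) ^ (2 * r₀ + 3) ≤ C * Real.exp (1 / 8 * ∑ i : Fin 4, (z i) ^ 2) := by
    refine le_trans (hCle ‖z‖ hz) (mul_le_mul_of_nonneg_left ?_ hC.le)
    exact Real.exp_le_exp.mpr (by linarith [norm_sq_le_sum_sq z])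
  calc ‖iteratedFDeriv ℝ k (pertK g) z‖ ≤ g * A * (1 + ‖z‖) ^ (2 * r₀ + 3) := step1
    _ ≤ g * A * (C * Real.exp (1 / 8 * ∑ i : Fin 4, (z i) ^ 2)) :=
        mul_le_mul_of_nonneg_left step2 (by positivity)
    _ = A * C * g * Real.exp (1 / 8 * ∑ i : Fin 4, (z i) ^ 2) := by ring

end Summit.HubbardSuperconductivity.HubbardSuperconductivity.Theorems.ComplexGFF

end
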